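import Mathlib
import HarnessLib
import Literature.Probability.RandomPlanarGeometry.CLE
import Literature.Topology.PlaneTopology.JordanCurveProofs
import Summits.CriticalPhenomena.SAWScalingLimit.Theorems.SAWLoopLiftWernerDeterminationTopology

/-!
# Werner determination (route SAWLoopLift, item stmt-CriticalPhenomena-4851) — simple loop traces and
the Jordan curve theorem

Helper file (`--supports stmt-CriticalPhenomena-4851`). The measures of the route item `WernerDetermination`
are carried by traces `T = γ.range` of simple loops `γ ∈ CurveClass.simpleLoop` (a closed curve injective on
`[0, 1)`). We bridge this hypothesis to the tree's Jordan curve theorem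
(`Literature.Topology.PlaneTopology.JordanCurveTheorem_holds`, McCleary Ch. 9) and record the consequences
consumed by the determination argument:

* `nonempty_homeomorph_addCircle_of_simpleLoop` — such a trace is homeomorphic to the circle (periodic
  extension of a representative, `range_homeomorphic_addCircle`);
* `isPreconnected_of_simpleLoop` — it is connected;
* `good_of_simpleLoop` — if it surrounds `q` then (J1) every point off `T` lies in the component of `q` or
  in an unbounded component of `Tᶜ`, and (J2) `T` lies in the closure of its exterior (the two
  complementary components of the Jordan curve theorem, with common frontier `T`);
* `exists_mem_evt_of_simpleLoop` — a simple loop trace inside `B(0, R)` surrounds a point `d` of any dense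
  set and is not inside a small rational disc `B(d, r) ⊆ B(0, R)` around it: the countable cover of the
  carrier used in the main file.

No new definitions. References: W. Werner, J. Amer. Math. Soc. 21 (2008), §3; J. McCleary, *A First Course
in Topology* (2006), Ch. 9.
-/

noncomputable section

namespace Summit.CriticalPhenomena.SAWScalingLimit.Theorems.WernerDetermination

open Set Metric Bornology Topology Filter TopologicalSpace
open Literature.Probability.RandomPlanarGeometry
open Literature.Topology.PlaneTopology (JordanCurveTheorem_holds range_homeomorphic_addCircle)

/-! ### Simple loop traces are Jordan curves -/

/-- **A simple loop trace is homeomorphic to the circle.** If `T` is the range of a curve class in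
`CurveClass.simpleLoop` (some representative `c : [0,1] → ℂ` is closed and injective on `[0, 1)`), then the
`1`-periodic extension `t ↦ c (fract t)` is continuous, injective on `[0, 1)` with range `T`, so
`T ≃ₜ ℝ/ℤ` (`range_homeomorphic_addCircle`). [folklore] -/
theorem nonempty_homeomorph_addCircle_of_simpleLoop {T : Set ℂ}
    (h : ∃ γ : CurveClass ℂ, γ ∈ (CurveClass.simpleLoop : Set (CurveClass ℂ)) ∧ γ.range = T) :
    Nonempty (AddCircle (1 : ℝ) ≃ₜ T) := by
  obtain ⟨γ, ⟨c, hc, rfl⟩, hT⟩ := h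
  rw [CurveClass.range_mk] at hT
  obtain ⟨hloop, hinj⟩ := hc
  have h01 : c 0 = c 1 := hloop
  -- the representative, extended to `ℝ` by projection, then made periodic
  set f : ℝ → ℂ := fun s => c (projIcc 0 1 zero_le_one s) with hf
  have hfc : Continuous f := c.continuous.comp continuous_projIcc
  have hf0 : f 0 = f 1 := by
    simp only [hf, projIcc_left, projIcc_right]
    exact h01
  set g : ℝ → ℂ := f ∘ Int.fract with hg
  have hgc : Continuous g := hfc.continuousOn.comp_fract'' hf0
  have hgp : Function.Periodic g 1 := fun t => by
    simp only [hg, Function.comp_apply, Int.fract_add_one]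
  have hg_of_mem : ∀ {s : ℝ} (hs : s ∈ Ico (0 : ℝ) 1), g s = c ⟨s, hs.1, hs.2.le⟩ := fun {s} hs => by
    simp only [hg, hf, Function.comp_apply, Int.fract_eq_self.2 ⟨hs.1, hs.2⟩,
      projIcc_of_mem zero_le_one ⟨hs.1, hs.2.le⟩]
  have hginj : InjOn g (Ico 0 1) := by
    intro s hs t ht hst
    rw [hg_of_mem hs, hg_of_mem ht] at hst
    have hs1 : (⟨s, hs.1, hs.2.le⟩ : unitInterval) ∈ Iio (1 : unitInterval) := by
      change (⟨s, hs.1, hs.2.le⟩ : unitInterval) < 1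
      exact Subtype.mk_lt_mk.2 hs.2
    have ht1 : (⟨t, ht.1, ht.2.le⟩ : unitInterval) ∈ Iio (1 : unitInterval) := by
      change (⟨t, ht.1, ht.2.le⟩ : unitInterval) < 1
      exact Subtype.mk_lt_mk.2 ht.2
    exact congrArg Subtype.val (hinj hs1 ht1 hst)
  have hrange : range g = T := by
    rw [← hT]
    refine Subset.antisymm ?_ ?_
    · rintro _ ⟨t, rfl⟩
      exact ⟨_, rfl⟩
    · rintro _ ⟨x, rfl⟩
      rcases lt_or_eq_of_le x.2.2 with hx1 | hx1
      · refine ⟨x, ?_⟩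
        rw [hg_of_mem ⟨x.2.1, hx1⟩]
      · refine ⟨0, ?_⟩
        rw [hg_of_mem ⟨le_rfl, zero_lt_one⟩]
        have hx : x = 1 := Subtype.ext hx1
        rw [hx]
        exact h01
  rw [← hrange]
  exact range_homeomorphic_addCircle hgc hgp hginj

/-- **A simple loop trace is connected** (continuous image of `[0, 1]`). [folklore] -/
theorem isPreconnected_of_simpleLoop {T : Set ℂ}
    (h : ∃ γ : CurveClass ℂ, γ ∈ (CurveClass.simpleLoop : Set (CurveClass ℂ)) ∧ γ.range = T) :
    IsPreconnected T := by
  obtain ⟨γ, ⟨c, -, rfl⟩, hT⟩ := h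
  rw [CurveClass.range_mk] at hT
  rw [← hT]
  exact isPreconnected_range c.continuous

/-! ### Consequences of the Jordan curve theorem -/

/-- **The two sides of a simple loop surrounding `q`.** If the simple loop trace `T` surrounds `q`
(`q ∉ T`, `cc(Tᶜ, q)` bounded) then, by the Jordan curve theorem (`JordanCurveTheorem_holds`): (J1) every
point off `T` lies in `cc(Tᶜ, q)` or in an unbounded component of `Tᶜ`, and (J2) `T` lies in the closure of
its exterior `{w ∉ T | cc(Tᶜ, w) unbounded}`. [folklore] -/
theorem good_of_simpleLoop {T : Set ℂ}
    (h : ∃ γ : CurveClass ℂ, γ ∈ (CurveClass.simpleLoop : Set (CurveClass ℂ)) ∧ γ.range = T)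
    {q : ℂ} (hq : q ∉ T) (hqb : IsBounded (connectedComponentIn Tᶜ q)) :
    (q ∉ T ∧ IsBounded (connectedComponentIn Tᶜ q)) ∧
      (∀ w : ℂ, w ∉ T → w ∈ connectedComponentIn Tᶜ q ∨ ¬ IsBounded (connectedComponentIn Tᶜ w)) ∧
      T ⊆ closure {w : ℂ | w ∉ T ∧ ¬ IsBounded (connectedComponentIn Tᶜ w)} := by
  obtain ⟨U, V, hUo, hVo, hUc, hVc, hUV, hUVT, -, hfV, hUb, hVb⟩ :=
    JordanCurveTheorem_holds.exists_isBounded (nonempty_homeomorph_addCircle_of_simpleLoop h)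
  -- points of `V` are exterior points
  have hVext : ∀ w ∈ V, w ∉ T ∧ ¬ IsBounded (connectedComponentIn Tᶜ w) := fun w hw => by
    have hwT : w ∈ Tᶜ := hUVT ▸ Or.inr hw
    exact ⟨hwT, fun hb => hVb (hb.subset
      (hVc.isPreconnected.subset_connectedComponentIn hw (hUVT ▸ subset_union_right)))⟩
  -- the component of `q` is `U`
  have hqU : q ∈ U := by
    rcases (hUVT.symm ▸ hq : q ∈ U ∪ V) with h' | h'
    · exact h'
    · exact absurd hqb (hVext q h').2
  have hccU : connectedComponentIn Tᶜ q = U := by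
    refine Subset.antisymm ?_ (hUc.isPreconnected.subset_connectedComponentIn hqU (hUVT ▸ subset_union_left))
    have hsub : connectedComponentIn Tᶜ q ⊆ U ∪ V := hUVT.symm ▸ connectedComponentIn_subset _ _
    exact isPreconnected_connectedComponentIn.subset_left_of_subset_union hUo hVo hUV hsub
      ⟨q, mem_connectedComponentIn hq, hqU⟩
  refine ⟨⟨hq, hqb⟩, fun w hw => ?_, ?_⟩
  · rcases (hUVT.symm ▸ hw : w ∈ U ∪ V) with h' | h'
    · exact Or.inl (hccU ▸ h')
    · exact Or.inr (hVext w h').2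
  · calc T = frontier V := hfV.symm
      _ ⊆ closure V := frontier_subset_closure
      _ ⊆ closure {w : ℂ | w ∉ T ∧ ¬ IsBounded (connectedComponentIn Tᶜ w)} :=
        closure_mono fun w hw => hVext w hw

/-- **A simple loop trace surrounds some point**: there is a point off `T` whose component in `Tᶜ` is
bounded and open-ly so — more precisely a nonempty open set `U ⊆ Tᶜ` of such points, contained in any disc
containing `T`. [folklore] -/
theorem exists_isOpen_surround_of_simpleLoop {T : Set ℂ}
    (h : ∃ γ : CurveClass ℂ, γ ∈ (CurveClass.simpleLoop : Set (CurveClass ℂ)) ∧ γ.range = T)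
    {R : ℝ} (hTR : T ⊆ ball 0 R) :
    ∃ U : Set ℂ, IsOpen U ∧ U.Nonempty ∧ U ⊆ ball 0 R ∧
      ∀ w ∈ U, w ∉ T ∧ IsBounded (connectedComponentIn Tᶜ w) := by
  obtain ⟨U, V, hUo, hVo, hUc, hVc, hUV, hUVT, -, -, hUb, hVb⟩ :=
    JordanCurveTheorem_holds.exists_isBounded (nonempty_homeomorph_addCircle_of_simpleLoop h)
  have hUT : U ⊆ Tᶜ := hUVT ▸ subset_union_left
  -- the connected unbounded set `(ball 0 R)ᶜ ⊆ Tᶜ` lies in `V`, so `U ⊆ ball 0 R`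
  have hcb : (ball (0 : ℂ) R)ᶜ ⊆ V := by
    have hsub : (ball (0 : ℂ) R)ᶜ ⊆ U ∪ V := hUVT.symm ▸ compl_subset_compl.2 hTR
    rcases (isPreconnected_compl_ball 0 R).subset_or_subset hUo hVo hUV hsub with h' | h'
    · exact absurd (hUb.subset h') (not_isBounded_compl isBounded_ball)
    · exact h'
  refine ⟨U, hUo, hUc.nonempty, fun w hw => ?_, fun w hw => ⟨hUT hw, hUb.subset ?_⟩⟩
  · by_contra hwR
    exact Set.disjoint_left.1 hUV hw (hcb hwR)
  · have hsub : connectedComponentIn Tᶜ w ⊆ U ∪ V := hUVT.symm ▸ connectedComponentIn_subset _ _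
    exact isPreconnected_connectedComponentIn.subset_left_of_subset_union hUo hVo hUV hsub
      ⟨w, mem_connectedComponentIn (hUT hw), hw⟩

/-- **The countable cover of the carrier.** A simple loop trace `T ⊆ B(0, R)` (as a nonempty compact set)
lies in the event `E(B(0,R), B(d,r), d) = {T ⊆ B(0,R) ∧ d ∉ T ∧ cc(Tᶜ,d) bounded ∧ ¬ T ⊆ B(d,r)}` for some
point `d` of a given dense set and some rational radius `r > 0` with `B(d, r) ⊆ B(0, R)`. [folklore] -/
theorem exists_mem_evt_of_simpleLoop {D : Set ℂ} (hD : Dense D) {T : NonemptyCompacts ℂ}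
    (h : ∃ γ : CurveClass ℂ, γ ∈ (CurveClass.simpleLoop : Set (CurveClass ℂ)) ∧ γ.range = (T : Set ℂ))
    {R : ℝ} (hTR : (T : Set ℂ) ⊆ ball 0 R) :
    ∃ d ∈ D, ∃ r : ℚ, (0 : ℝ) < r ∧ ball d (r : ℝ) ⊆ ball 0 R ∧
      ((T : Set ℂ) ⊆ ball 0 R ∧ d ∉ (T : Set ℂ) ∧ IsBounded (connectedComponentIn (T : Set ℂ)ᶜ d) ∧
        ¬ (T : Set ℂ) ⊆ ball d (r : ℝ)) := by
  obtain ⟨U, hUo, hUne, hUR, hU⟩ := exists_isOpen_surround_of_simpleLoop h hTR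
  obtain ⟨d, hdU, hdD⟩ := hD.inter_open_nonempty U hUo hUne
  obtain ⟨hdT, hdb⟩ := hU d hdU
  have hTne : (T : Set ℂ).Nonempty := T.nonempty
  have h1 : 0 < infDist d (T : Set ℂ) := by
    rw [← infDist_pos_iff_notMem_closure hTne, T.isCompact.isClosed.closure_eq]
    exact hdT
  have h2 : 0 < R - ‖d‖ := by
    have := hUR hdU
    rw [mem_ball, dist_zero_right] at this
    linarith
  obtain ⟨r, hr0, hr⟩ := exists_rat_btwn (lt_min h1 h2)
  have hr0' : (0 : ℝ) < r := by exact_mod_cast hr0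
  refine ⟨d, hdD, r, hr0', fun y hy => ?_, hTR, hdT, hdb, fun hsub => ?_⟩
  · rw [mem_ball, dist_zero_right]
    rw [mem_ball] at hy
    calc ‖y‖ = ‖(y - d) + d‖ := by ring_nf
      _ ≤ ‖y - d‖ + ‖d‖ := norm_add_le _ _
      _ < R := by rw [← dist_eq_norm]; linarith [min_le_right (infDist d (T : Set ℂ)) (R - ‖d‖)]
  · obtain ⟨t, ht⟩ := hTne
    have h3 : infDist d (T : Set ℂ) ≤ dist d t := infDist_le_dist_of_mem ht
    have h4 : dist t d < r := hsub ht
    rw [dist_comm] at h4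
    linarith [min_le_left (infDist d (T : Set ℂ)) (R - ‖d‖)]

end Summit.CriticalPhenomena.SAWScalingLimit.Theorems.WernerDetermination
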